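import Mathlib.LinearAlgebra.Matrix.PosDef
import Mathlib.Analysis.SpecialFunctions.Pow.Real
import Mathlib.Algebra.Order.Star.Real
import HarnessLib

/-!
# Marcus–Spielman–Srivastava, *Interlacing families II* — Theorem 1.4

The main theorem of Marcus–Spielman–Srivastava's solution of the Kadison–Singer problem
(Ann. of Math. 182 (2015) 327–350 = arXiv:1306.3969v4, Theorem 1.4, p. 3), vendored as a NAMED FACT
(D-0014): for independent random vectors `v₁, …, vₘ` with finite support in isotropic position
(`Σ 𝔼 vᵢvᵢ* = I`) and `𝔼‖vᵢ‖² ≤ ε`, some outcome has `‖Σ vᵢvᵢ*‖ ≤ (1 + √ε)²`.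

## Formalisation choices
* "independent random vectors with finite support" and "`P[·] > 0`": the law of `vᵢ` is a finite type
  `S i` of outcomes with positive weights `p i s` summing to `1` and values `v i s`; for independent
  finitely supported vectors the event has positive probability iff SOME point `σ` of the product of the
  supports realises it, which is how the conclusion is stated (`∃ σ : (i : ι) → S i, …`). No measure
  theory is needed and nothing is lost.
* `vᵢvᵢ*` is `Matrix.vecMulVec (v i s) (v i s)`; `‖vᵢ‖²` is `v i s ⬝ᵥ v i s`; the operator-norm bound
  `‖M‖ ≤ t` for the positive semidefinite `M = Σ vᵢvᵢᵀ` is stated as `(t • 1 - M).PosSemidef`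
  (equivalent for real symmetric PSD `M`).
* Stated over `ℝ^d` (`Fin d → ℝ`), the case used by the tree's consumers (Summits/PneNP route
  `Nc03AvoidResidualCore`, rung F-N1b-subexp: existence of LMI-certified range avoiders via ridge padding).
  A real vector is a complex vector with `v v* = v vᵀ`, so this is an instance of the printed `ℂ^d` statement.
  -- TODO(general form): the printed statement over `ℂ^d` (conjugate-transpose outer products).

## Not here
Corollary 1.5 (Weaver KS_r partition form), Theorem 4.1 (mixed characteristic polynomial formula) and
Theorem 5.1 (largest-root bound) of the same paper; the interlacing-family method itself.

## References
* [MarcusSpielmanSrivastava2015b] A. W. Marcus, D. A. Spielman, N. Srivastava, *Interlacing families II: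
  Mixed characteristic polynomials and the Kadison–Singer problem*, Ann. of Math. 182 (2015) 327–350,
  doi:10.4007/annals.2015.182.1.8, arXiv:1306.3969 (v4, 14 Apr 2014): Theorem 1.4 p. 3 (proof end of §5).
-/

namespace Literature.LinearAlgebra.Matrix

open scoped BigOperators

/-- **Marcus–Spielman–Srivastava 2015 (Interlacing families II), Theorem 1.4**, verbatim (arXiv v4 p. 3):
"If `ε > 0` and `v₁, …, vₘ` are independent random vectors in `ℂ^d` with finite support such that
`Σ_{i=1}^m 𝔼 vᵢvᵢ* = I_d`, and `𝔼‖vᵢ‖² ≤ ε` for all `i`, then `P[‖Σ_{i=1}^m vᵢvᵢ*‖ ≤ (1 + √ε)²] > 0`."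

Lean reading (real case; see the module docstring): `ι` indexes the vectors (`m = |ι|`), `S i` is the finite
support of `vᵢ` with law `p i` (positive weights summing to `1`), `v i s : Fin d → ℝ` its values;
hypotheses: isotropy `Σ_i Σ_s p i s • (v i s)(v i s)ᵀ = 1` and `Σ_s p i s · ‖v i s‖² ≤ ε` for every `i`;
conclusion: some outcome `σ` (one support point per `i`) has `(1 + √ε)² • 1 − Σ_i (v i (σ i))(v i (σ i))ᵀ`
positive semidefinite, i.e. `‖Σ_i vᵢvᵢᵀ‖ ≤ (1 + √ε)²`.
[cite: MarcusSpielmanSrivastava2015b, Thm 1.4] -/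
def MarcusSpielmanSrivastava2015_thm14 : Prop :=
  ∀ (d : ℕ) (ι : Type) [Fintype ι] (S : ι → Type) [∀ i, Fintype (S i)]
    (p : (i : ι) → S i → ℝ) (v : (i : ι) → S i → Fin d → ℝ) (ε : ℝ),
    0 < ε →
    (∀ i s, 0 < p i s) →
    (∀ i, ∑ s, p i s = 1) →
    (∑ i, ∑ s, p i s • Matrix.vecMulVec (v i s) (v i s) = (1 : Matrix (Fin d) (Fin d) ℝ)) →
    (∀ i, ∑ s, p i s * (v i s ⬝ᵥ v i s) ≤ ε) →
    ∃ σ : (i : ι) → S i,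
      ((1 + Real.sqrt ε) ^ 2 • (1 : Matrix (Fin d) (Fin d) ℝ)
        - ∑ i, Matrix.vecMulVec (v i (σ i)) (v i (σ i))).PosSemidef

/-- Deterministic special case of `MarcusSpielmanSrivastava2015_thm14` (every support a single point):
if `Σ_i vᵢvᵢᵀ = 1` then trivially `‖Σ vᵢvᵢᵀ‖ = 1 ≤ (1 + √ε)²` (any `ε`; `√ε ≥ 0`). Recorded as a
sanity check that the fact's hypotheses are jointly satisfiable and its conclusion has the intended
reading (it is proved here without the fact). [cite: MarcusSpielmanSrivastava2015b, Thm 1.4] -/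
theorem MarcusSpielmanSrivastava2015_thm14.deterministic_case
    (d : ℕ) (ι : Type) [Fintype ι] (v : ι → Fin d → ℝ) (ε : ℝ)
    (hiso : ∑ i, Matrix.vecMulVec (v i) (v i) = (1 : Matrix (Fin d) (Fin d) ℝ)) :
    ((1 + Real.sqrt ε) ^ 2 • (1 : Matrix (Fin d) (Fin d) ℝ)
        - ∑ i, Matrix.vecMulVec (v i) (v i)).PosSemidef := by
  rw [hiso]
  have h1 : (1 + Real.sqrt ε) ^ 2 • (1 : Matrix (Fin d) (Fin d) ℝ) - 1
      = (Real.sqrt ε * (2 + Real.sqrt ε)) • (1 : Matrix (Fin d) (Fin d) ℝ) := by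
    rw [show Real.sqrt ε * (2 + Real.sqrt ε) = (1 + Real.sqrt ε) ^ 2 - 1 by ring, sub_smul, one_smul]
  rw [h1]
  exact Matrix.PosSemidef.one.smul (by positivity)

end Literature.LinearAlgebra.Matrix
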